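import Mathlib
import Literature.Probability.LatticeModels.ScalingLimit3D
import Literature.Probability.LatticeModels.UrsellFourCurrents
import Summits.CriticalPhenomena.Ising3DConformalLimit.Theses.HyperoctahedralRP

/-!
Sketch for crux-ideate on stmt-CriticalPhenomena-0636 (IsingEuclidUpgrade_r4_nonGaussian):
first lemmas of the three idea cards, stated over existing declarations (no proofs).
-/

noncomputable section

open Filter MeasureTheory Finset
open scoped Topology symmDiff

namespace Summit.CriticalPhenomena.Ising3DConformalLimit.Cruxes.IsingEuclidUpgrade_r4_nonGaussian

open Literature.Probability.LatticeModels

/-! ### Card A — free-covariance-delta-dichotomy: Lamperti's lemma for correlation families -/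

/-- First lemma of card `free-covariance-delta-dichotomy` (Lamperti-type): a full-filter pointwise
scaling limit of the critical correlators with non-degenerate two-point function is automatically
scale covariant ON NON-COINCIDENT CONFIGURATIONS with a definite dimension `Δ ∈ [1/2, 1]`, and the
renormalisation is regularly varying of index `-Δ` along the filter `𝓝[>] 0`. No covariance or
measurability hypothesis on `ρ`. -/
def FreeScaleCovariance : Prop :=
  ∀ (ρ : ℝ → ℝ) (S : CorrFamily 3), (∀ δ ∈ Set.Ioc (0:ℝ) 1, 0 < ρ δ) →
    HasPointwiseScalingLimit (criticalCorr 3) ρ S → IsNondegenerateTwoPoint S →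
    ∃ Δ : ℝ, 1/2 ≤ Δ ∧ Δ ≤ 1 ∧
      (∀ c : ℝ, 0 < c → Tendsto (fun δ => ρ (c * δ) / ρ δ) (𝓝[>] (0:ℝ)) (𝓝 (c ^ (-Δ)))) ∧
      ∀ (n : ℕ) (x : Fin n → EuclideanSpace ℝ (Fin 3)), x ∈ NonCoincident 3 n →
        ∀ c : ℝ, 0 < c → S n (fun i => c • x i) = c ^ (-((n : ℝ) * Δ)) * S n x

/-- The dichotomy assembly of card A (shape only): a branch engine for `Δ = 1/2` and a branch
engine for `Δ > 1/2` give the crux. Both branch statements are quantified exactly like the crux,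
with the extra branch hypothesis expressed through `FreeScaleCovariance`'s `Δ`. -/
def MeanFieldBranch : Prop :=
  ∀ (ρ : ℝ → ℝ) (S : CorrFamily 3), (∀ δ ∈ Set.Ioc (0:ℝ) 1, 0 < ρ δ) →
    HasPointwiseScalingLimit (criticalCorr 3) ρ S → IsNondegenerateTwoPoint S →
    (∀ c : ℝ, 0 < c → Tendsto (fun δ => ρ (c * δ) / ρ δ) (𝓝[>] (0:ℝ)) (𝓝 (c ^ (-(1/2:ℝ))))) →
    HasNontrivialU4 S

def AnomalousBranch : Prop :=
  ∀ (ρ : ℝ → ℝ) (S : CorrFamily 3) (Δ : ℝ), (∀ δ ∈ Set.Ioc (0:ℝ) 1, 0 < ρ δ) →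
    HasPointwiseScalingLimit (criticalCorr 3) ρ S → IsNondegenerateTwoPoint S →
    1/2 < Δ → Δ ≤ 1 →
    (∀ c : ℝ, 0 < c → Tendsto (fun δ => ρ (c * δ) / ρ δ) (𝓝[>] (0:ℝ)) (𝓝 (c ^ (-Δ)))) →
    HasNontrivialU4 S

/-- The glue of card A is pure logic (checked here). -/
theorem crux_of_dichotomy (hL : FreeScaleCovariance) (hA : MeanFieldBranch) (hB : AnomalousBranch) :
    Theses.HyperoctahedralRP.IsingEuclidUpgradeR4NonGaussian := by
  intro ρ S hρ hlim hnd
  obtain ⟨Δ, h12, h1, hrv, -⟩ := hL ρ S hρ hlim hnd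
  rcases eq_or_lt_of_le h12 with h | h
  · refine hA ρ S hρ hlim hnd ?_
    intro c hc
    simpa [← h] using hrv c hc
  · exact hB ρ S Δ hρ hlim hnd h h1 hrv

/-! ### Card B — four-current positivity & switching-coset robustness -/

section finiteGraph
variable {V : Type*} [Fintype V] [DecidableEq V] (G : SimpleGraph V) [DecidableRel G.Adj]

/-- First lemma of card `four-current-coset-robustness`: the "all four sources in one cluster"
form of the random-current identity on a finite graph (free b.c., zero field, `β ≥ 0`):
`U₄(x,y,z,t) = -2 ⟨σ_xσ_yσ_zσ_t⟩ · P^{{x}∆{y}∆{z}∆{t}, ∅}[x ⟷ y, x ⟷ z, x ⟷ t in n₁+n₂]`,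
obtained from `ursellFour_eq_doubleCurrent` by one more switching (`{x,y}`,`{z,t}` → all four, `∅`)
and the parity remark `{x ⟷ z} ∩ 𝓕_{zt} = {all four connected}`. -/
def ursellFour_eq_fourSource_allConnected : Prop :=
  ∀ {β : ℝ} (_hβ : 0 ≤ β) (x y z t : V),
    connectedFour (isingMeasure G univ β 0 .free) spinAt ![x, y, z, t] =
      -2 * isingExpect G univ β 0 .free (spinMonomial ![x, y, z, t]) *
        (doubleCurrentMeasure G β ((({x} : Finset V) ∆ {y}) ∆ (({z} : Finset V) ∆ {t})) ∅).real
          (tracedConn G x y ∩ tracedConn G x z ∩ tracedConn G x t)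

end finiteGraph

/-! ### Card C — contact-corner value and the pair-state spectral measure -/

/-- First lemma (a) of card `contact-corner-no-uv-escape`: the exact CONTACT VALUE of the critical
lattice Ursell function when two of the four points coincide, `U₄(x,y,y,t) = -2⟨σ_xσ_y⟩⟨σ_yσ_t⟩`
(from `σ_y² = 1`). -/
def ContactCornerValue : Prop :=
  ∀ (x y t : Site 3),
    criticalCorr 3 4 ![x, y, y, t] -
      (criticalCorr 3 2 ![x, y] * criticalCorr 3 2 ![y, t] +
        criticalCorr 3 2 ![x, y] * criticalCorr 3 2 ![y, t] +
        criticalCorr 3 2 ![x, t] * criticalCorr 3 2 ![y, y]) =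
      -2 * criticalCorr 3 2 ![x, y] * criticalCorr 3 2 ![y, t]

/-- First lemma (b): along a lattice axis, for the mirror-symmetric collinear family
`(0, r e₀, (r+g) e₀, (2r+g) e₀)`, the covariance of the pair products,
`K(r,g) = ⟨σ₀σ_{re₀}σ_{(r+g)e₀}σ_{(2r+g)e₀}⟩ - ⟨σ₀σ_{re₀}⟩²`, is a Hausdorff moment sequence in the
gap `g` (reflection positivity through the mid-plane + transfer-operator spectral calculus): there is
a finite positive measure `ν_r` on `[-1,1]` with `K(r,g) = ∫ λ^g dν_r`. -/
def PairStateMomentSequence : Prop :=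
  ∀ r : ℕ, 0 < r → ∃ ν : Measure ℝ, IsFiniteMeasure ν ∧ ν (Set.Icc (-1:ℝ) 1)ᶜ = 0 ∧
    ∀ g : ℕ,
      criticalCorr 3 4 ![0, Pi.single 0 (r:ℤ), Pi.single 0 ((r:ℤ) + g), Pi.single 0 (2*(r:ℤ) + g)] -
        (criticalCorr 3 2 ![0, Pi.single 0 (r:ℤ)]) ^ 2 = ∫ l, l ^ g ∂ν

end Summit.CriticalPhenomena.Ising3DConformalLimit.Cruxes.IsingEuclidUpgrade_r4_nonGaussian

end
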